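import Summits.BirchSwinnertonDyer.BirchSwinnertonDyer.Theorems.ClassRecordThreeEulerHalvesAtThreeWalkSupplyAtThreeGross1991
import HarnessLib

/-!
# PORT 3 ↦ p, layer 2a (crux `EulerHalfNotRamNoInertSetAtFive`, item stmt-BirchSwinnertonDyer-19715, deciding stub `stub_jetchevAtP`; RULING 52):
# the per-level SELMER SUPPLY from Poitou–Tate + Gross 1991 (§6), and the finiteness of `ord_p(P_s)` at `M(s) = ∞`, AT A GENERAL ODD PRIME `p`

Cell `bsd-stepL`, seat `bsd-line-er5-p1-w2` (D-0154 width seat -w2; lead `bsd-line-er5-p1`), `--supports stmt-BirchSwinnertonDyer-19715`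
(helper). THEOREMS ONLY, Theses-free (r3), namespace `…X11b.AtP.Koly` (P3). The p = 3 originals (NOT edited):
`Three.Koly.selmerSupplyAtThree_of_poitouTate_Gross1991` (`…WalkSupplyAtThreeGross1991.lean`, tam3-p1 g8) and
`Three.Koly.divOrd_ne_top_of_levelIndex_eq_top` (`…WalkSupplyAtThreeSharp.lean`). (P1) certificate: these are 2 of the 9 statements at
p = 3 in the used-constant cone of the port targets; everything they call is p-generic (`exists_carrierPackage_kolyvagin`,
`exists_dualityConjuncts_of_localFacts`, `kolyvaginLocalTerm_of_poitouTate`, `natCard_map_localization_signPart_relaxedAt`,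
`RingClassTransverse.dualTransported_eq_of_localTransverseFamily`, `forall_hGZ_of_Gross1991`, `KolyCert.*_of_dvd_zhang`, … all take `p`).
PORT RULE (P2): `3 ↦ (p : ℕ) [Fact p.Prime]` with the weakest side condition used — `p ≠ 2`; the frame gains the explicit binder
`NumberField.discr K ≠ -3` (the originals derive it from `3 ∤ d_K`, which has no analogue at `p ≠ 3`); `2 ≤ p ^ k` from `p.two_le`. The rest is
the original text (audit by diff).

* `divOrd_ne_top_of_levelIndex_eq_top` — `M(s) = ∞` forces `s = 1`, and `ord_p(y_K) < ∞` (non-torsion Heegner point, Mordell–Weil).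
  -- adapted from Summits/BirchSwinnertonDyer/BirchSwinnertonDyer/Theorems/ClassRecordThreeEulerHalvesAtThreeWalkSupplyAtThreeSharp.lean
* `selmerSupplyAtP_of_poitouTate_Gross1991` — the SHARP per-frame, per-level Selmer supply (transverse family, carrier package, (δ) of order
  `p^t`, root-class membership, duality conjuncts) from `hPT` (`poitouTate_selmerStructure_duality_conj`) + `hF1`
  (`Gross1991_heegnerPoint_sub_ratTorsion_mem_E0`), at every AtP frame.
  -- adapted from Summits/BirchSwinnertonDyer/BirchSwinnertonDyer/Theorems/ClassRecordThreeEulerHalvesAtThreeWalkSupplyAtThreeGross1991.lean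

HONEST FRAMING: CONDITIONAL on the two displayed named facts (`hPT` typed-not-proved, `hF1` printed, Gross 1991 §6); nothing booked; no census
label moves (T7); `stub_jetchevAtP` and crux 19715 are NOT closed by this layer; BSD is proved for no curve.
[cite: GrossLMS1991, §6 (p. 251), Prop. 5.3] [cite: McCallumLMS1991, §5 (p. 303)] [cite: MilneADT2006, Ch. I, Thm. 4.10(b)] [cite: Jetchev2008, Thm. 1.4]
-/

set_option autoImplicit false

noncomputable section

open scoped Classical NumberField Pointwise

namespace Summit.BirchSwinnertonDyer.Rank1Residual.X11b.AtP.Koly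

open WeierstrassCurve IsDedekindDomain NumberField Field Literature.NumberTheory.EllipticCurves
  Literature.NumberTheory.EllipticCurves.ModularForms Literature.NumberTheory.EllipticCurves.Jetchev2008
  Literature.NumberTheory.EllipticCurves.KolyvaginCocycle
  Literature.NumberTheory.EllipticCurves.Rank1Residual Literature.NumberTheory.GaloisRepresentations
  Literature.NumberTheory.GaloisRepresentations.DiscreteGaloisModule
  Literature.NumberTheory.GaloisCohomology Literature.NumberTheory.Automorphic
  Summit.BirchSwinnertonDyer.Rank1Residual.X11b Summit.BirchSwinnertonDyer.Rank1Residual.JET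
  Summit.BirchSwinnertonDyer.Rank1Residual.JET.SelmerVocabulary
  Summit.BirchSwinnertonDyer.Rank1Residual.JET.Walk
  Summit.BirchSwinnertonDyer.Rank1Residual.X11b.Three.Koly

/-- **On the stub's frames, `ord₃ P_s < ∞` whenever `M(s) = ∞`** (the input `hdivfin` of
`Koly.hκt_of_selmerMembership`): `M(s) = ∞` forces `s = 1`; the derived point of ANY conductor-`1` datum is
the image of a Heegner point `P₀ ∈ E(K)` (`heegnerSystem_exists_isHeegnerPoint_map_eq_derivedPoint_one`,
granted Shimura reciprocity `hrec`), which is non-torsion (Gross–Zagier + modularity at `r_an = 1`,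
`L(E^{d_K},1) ≠ 0`); a non-torsion point of the finitely generated `E(K[1])` has finite `p`-depth.
[cite: GrossZagier1986, Thm. I.(6.3)] [cite: GrossLMS1991, §4 (P_1 = y_K)] -/
theorem divOrd_ne_top_of_levelIndex_eq_top (p : ℕ) [Fact p.Prime]
    (W : WeierstrassCurve ℚ) [W.IsElliptic] [W.IsGloballyMinimal] [NeZero (W.conductorNorm ℤ)]
    (K : Type) [Field K] [NumberField K]
    (hrec : heegnerPointOfConductor_one_galoisConj (W.conductorNorm ℤ) W K)
    (hGZ : gross_zagier (W.conductorNorm ℤ) W K) (hmod : hasEntireLFunction_rat)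
    (Dt : ModularParametrizationData W (W.conductorNorm ℤ)) (β : ℤ) (ι : K →+* ℂ)
    (hr : W.analyticRank = 1) (hK : IsImaginaryQuadratic K)
    (hHN : SatisfiesHeegnerHypothesis (W.conductorNorm ℤ) K)
    (hLt : (W.quadraticTwist (NumberField.discr K : ℚ)).entireLFunction 1 ≠ 0) {k : ℕ}
    (s : {m : ℕ // Squarefree m ∧ ∀ q ∈ m.primeFactors,
      Zhang2014.IsKolyvaginPrime (W.conductorNorm ℤ) W K p q ∧ k ≤ Zhang2014.kolyvaginIndex W p q})
    (d : KolyvaginHeegnerData Dt β ι s.1) (hM : Zhang2014.levelIndex W p s.1 = ⊤) :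
    divOrd d p ≠ ⊤ := by
  -- `M(s) = ∞` forces `s = 1`
  obtain ⟨m, hm⟩ := s
  have hm1 : m = 1 := by
    have hempty : m.primeFactors = ∅ := by
      by_contra hne
      obtain ⟨q, hq⟩ := Finset.nonempty_iff_ne_empty.mpr hne
      have hle : Zhang2014.levelIndex W p m ≤ (Zhang2014.kolyvaginIndex W p q : ℕ∞) :=
        Finset.inf_le hq
      rw [hM, top_le_iff] at hle
      exact ENat.coe_ne_top _ hle
    rcases Nat.primeFactors_eq_empty.mp hempty with h0 | h1
    · exact absurd h0 hm.1.ne_zero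
    · exact h1
  subst hm1
  -- the derived point of a conductor-1 datum is (the image of) a non-torsion Heegner point
  obtain ⟨P₀, ⟨Dt', H', ι', hP'⟩, hmap⟩ :=
    heegnerSystem_exists_isHeegnerPoint_map_eq_derivedPoint_one hrec hK hHN d
  have hnt : ¬ IsOfFinAddOrder P₀ :=
    X11b.not_isOfFinAddOrder_of_heegner_of_analyticRank_eq_one W (W.conductorNorm ℤ) K Dt' H' ι' P₀
      hGZ hmod hr hK hHN hLt hP'
  have hnt' : ¬ IsOfFinAddOrder d.derivedPoint := fun h ↦ hnt (by
    rw [← hmap] at h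
    exact ((WeierstrassCurve.Affine.Point.map_injective (W' := W)
      (f := (algebraMap K (ringClassField K ι 1)).toRatAlgHom)).isOfFinAddOrder_iff).mp h)
  -- finite `p`-depth in the finitely generated `E(K[1])`
  haveI : NumberField (ringClassField K ι 1) := numberField_ringClassField K hK ι 1
  haveI : Module.Finite ℤ (W.baseChange (ringClassField K ι 1)).toAffine.Point := by
    convert (W.baseChange (ringClassField K ι 1)).module_finite_point_holds
  obtain ⟨u, -, hnd⟩ := exists_exactDepth_of_not_isOfFinAddOrder (p := p) (Fact.out : p.Prime).one_lt hnt'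
  exact ne_top_of_le_ne_top (ENat.coe_ne_top u) (divOrd_le_of_not_pDiv d p hnd)

/-- **The registered stub `stub_supplyAtP` (v2) VERBATIM, modulo the two named Literature facts
`hPT` (Poitou–Tate for Selmer structures) and `hF1` (Gross 1991 §6 ∕ [GZ86 III (p.1)]: `y_n − t ∈ E₀`)
only** — see the module docstring. [cite: Jetchev2008, §p.1 item 7, §4.2, Prop. 4.5–4.9, Thm. 5.1,
Lemma 5.2 (pp. 814–823)] [cite: GrossLMS1991, §6 proof of Prop. 6.2 (1) (p. 245)]
[cite: GrossZagier1986, III (p.1)] [cite: Howard2004HeegnerKolyvagin, Prop. 2.1.9, Lemma 2.7.3]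
[cite: MilneADT2006, Ch. I, Thm. 4.10(b)] -/
theorem selmerSupplyAtP_of_poitouTate_Gross1991 (p : ℕ) [Fact p.Prime] (hp2 : p ≠ 2)
    -- NAMED LITERATURE FACTS (cite-only)
    (hPT : ∀ (K : Type) [Field K] [NumberField K], poitouTate_selmerStructure_duality_conj K)
    (hF1 : Gross1991_heegnerPoint_sub_ratTorsion_mem_E0)
    :
    ∀ (W : WeierstrassCurve ℚ) [W.IsElliptic] [W.IsGloballyMinimal] [NeZero (W.conductorNorm ℤ)]
      (K : Type) [Field K] [NumberField K]
      (Dt : ModularParametrizationData W (W.conductorNorm ℤ)) (β : ℤ) (ι : K →+* ℂ),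
      W.analyticRank = 1 → W.HasMultiplicativeReductionAtPrime p → Surj W p →
      IsImaginaryQuadratic K → SatisfiesHeegnerHypothesis (W.conductorNorm ℤ) K →
      Odd (NumberField.discr K) → NumberField.discr K ≠ -3 → (W.quadraticTwist (NumberField.discr K : ℚ)).entireLFunction 1 ≠ 0 →
      (4 * (W.conductorNorm ℤ : ℤ)) ∣ β ^ 2 - NumberField.discr K → ¬ (p : ℤ) ∣ Dt.c →
      ∀ (τ : K ≃ₐ[ℚ] K), τ ≠ 1 → ∀ (v : HeightOneSpectrum (𝓞 ℚ)) (k : ℕ), 1 ≤ k →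
        padicValNat p (W.tamagawaNumberAt v) ≤ k →
      ∀ (n : ℕ) (d : KolyvaginHeegnerData Dt β ι n) (hn : Squarefree n ∧ ∀ q ∈ n.primeFactors,
        Zhang2014.IsKolyvaginPrime (W.conductorNorm ℤ) W K p q ∧ k ≤ Zhang2014.kolyvaginIndex W p q),
      ∀ (D : ∀ s : {m : ℕ // Squarefree m ∧ ∀ q ∈ m.primeFactors,
        Zhang2014.IsKolyvaginPrime (W.conductorNorm ℤ) W K p q ∧ k ≤ Zhang2014.kolyvaginIndex W p q},
          KolyvaginHeegnerData Dt β ι s.1), D ⟨n, hn⟩ = d →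
      ∀ (ε : ℤ), (ε = 1 ∨ ε = -1) → ∀ (eb : ℕ → Bool),
        (∀ (m ℓ : ℕ), ℓ.Prime → ¬ ℓ ∣ m → eb (m * ℓ) = !eb m) →
        (∀ m, (if eb m then (1 : ℤ) else -1) = ε * (-1) ^ m.primeFactors.card) →
      ∃ (𝒯 𝒮 : SelmerStructure ((W.baseChange K).torsionGaloisModule ((p ^ k : ℕ) : ℤ)))
        (Qcar : Finset (HeightOneSpectrum (𝓞 K)))
        (C' : ℕ → AddSubgroup (galoisCohomology ((W.baseChange K).torsionGaloisModule ((p ^ k : ℕ) : ℤ)) 1)),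
        (∀ v, 𝒮 v ≤ (W.baseChange K).kummerSelmerStructure ((p ^ k : ℕ) : ℤ) v) ∧
        (∀ v ∈ Qcar, ((W.conductorNorm ℤ : ℕ) : 𝓞 K) ∈ v.asIdeal) ∧
        (∀ (ℓ : ℕ), Zhang2014.IsKolyvaginPrime (W.conductorNorm ℤ) W K p ℓ →
      k ≤ Zhang2014.kolyvaginIndex W p ℓ → ¬ ℓ ∣ n → ∀ v : HeightOneSpectrum (𝓞 K), (ℓ : 𝓞 K) ∈ v.asIdeal →
      Disjoint ((W.baseChange K).kummerSelmerStructure ((p ^ k : ℕ) : ℤ) (Sum.inr v)) (𝒯 (Sum.inr v))) ∧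
        (∀ (s : {m : ℕ // Squarefree m ∧ ∀ q ∈ m.primeFactors,
        Zhang2014.IsKolyvaginPrime (W.conductorNorm ℤ) W K p q ∧ k ≤ Zhang2014.kolyvaginIndex W p q})
      (ℓ : ℕ), Zhang2014.IsKolyvaginPrime (W.conductorNorm ℤ) W K p ℓ →
      k ≤ Zhang2014.kolyvaginIndex W p ℓ → ¬ ℓ ∣ s.1 → (∀ q ∈ s.1.primeFactors, q < ℓ) → n ∣ s.1 →
      ∀ v : HeightOneSpectrum (𝓞 K), (ℓ : 𝓞 K) ∈ v.asIdeal → ∀ b : Bool,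
      Nat.card ((signPart W K τ ((p ^ k : ℕ) : ℤ) (if b then 1 else -1)
          ((selmerF W ((p ^ k : ℕ) : ℤ) 𝒯 (placesDividing K s.1)).relaxedAt {v}).selmerGroup).map
        (galoisCohomology.localization ((W.baseChange K).torsionGaloisModule ((p ^ k : ℕ) : ℤ))
          (Sum.inr v) 1)) = p ^ k) ∧
        (∀ s (u : ℕ) (Q : (W.baseChange (ringClassField K ι s.1)).toAffine.Point)
      (hAk : IsAdmissible (absoluteGaloisGroup K) (D s).pointsSubgroup ((p ^ k : ℕ) : ℤ))
      (hQ : (D s).toGeomPoints Q ∈ invPoints (absoluteGaloisGroup K) (D s).pointsSubgroup ((p ^ k : ℕ) : ℤ)),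
      ((p ^ u : ℕ) : ℤ) • Q = (D s).derivedPoint →
      (¬ ∃ Q' : (W.baseChange (ringClassField K ι s.1)).toAffine.Point,
        ((p ^ (u + 1) : ℕ) : ℤ) • Q' = (D s).derivedPoint) →
      ((u + k : ℕ) : ℕ∞) ≤ Zhang2014.levelIndex W p s.1 →
      (kolyvaginClass (W.baseChange K) ((p ^ k : ℕ) : ℤ)
        ((W.baseChange K).zsmul_geomPoints_surjective_of_charZero
          (by exact_mod_cast pow_ne_zero k (Fact.out : p.Prime).ne_zero)) hAk ((D s).toGeomPoints Q) hQ :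
          galoisCohomology ((W.baseChange K).torsionGaloisModule ((p ^ k : ℕ) : ℤ)) 1) ∈
        (selmerF W ((p ^ k : ℕ) : ℤ) 𝒯 (placesDividing K s.1)).selmerGroup) ∧
        (∀ m, C' m ≤ signPart W K τ ((p ^ k : ℕ) : ℤ) (if !eb m then 1 else -1) ⊤) ∧
        (∀ s : {m : ℕ // Squarefree m ∧ ∀ q ∈ m.primeFactors,
        Zhang2014.IsKolyvaginPrime (W.conductorNorm ℤ) W K p q ∧ k ≤ Zhang2014.kolyvaginIndex W p q},
      n ∣ s.1 → ∃ (Qg Qg' : Type) (_ : AddCommGroup Qg) (_ : AddCommGroup Qg') (_ : Finite Qg')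
        (locq : signPart W K τ ((p ^ k : ℕ) : ℤ) (if !eb s.1 then 1 else -1)
            (selmerF W ((p ^ k : ℕ) : ℤ) 𝒯 (placesDividing K s.1)).selmerGroup →+ Qg)
        (locq' : C' s.1 →+ Qg'),
        (∀ x : C' s.1, locq' x = 0 ↔
          (x : galoisCohomology ((W.baseChange K).torsionGaloisModule ((p ^ k : ℕ) : ℤ)) 1) ∈
            signPart W K τ ((p ^ k : ℕ) : ℤ) (if !eb s.1 then 1 else -1)
              (selmerF W ((p ^ k : ℕ) : ℤ) 𝒯 (placesDividing K s.1)).selmerGroup) ∧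
        Nat.card locq.range * Nat.card locq'.range = Nat.card Qg' ∧ IsAddCyclic Qg' ∧
        Nat.card Qg' = p ^ padicValNat p (W.tamagawaNumberAt v)) ∧
        (∀ (s s' : {m : ℕ // Squarefree m ∧ ∀ q ∈ m.primeFactors,
        Zhang2014.IsKolyvaginPrime (W.conductorNorm ℤ) W K p q ∧ k ≤ Zhang2014.kolyvaginIndex W p q})
      (ℓ : ℕ), ℓ.Prime → ¬ ℓ ∣ s.1 → s'.1 = s.1 * ℓ → (∀ q ∈ s.1.primeFactors, q < ℓ) → n ∣ s.1 →
      ∀ v : HeightOneSpectrum (𝓞 K), (ℓ : 𝓞 K) ∈ v.asIdeal →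
      ((D s').kolyvaginClass (Fact.out : p.Prime) k :
          galoisCohomology ((W.baseChange K).torsionGaloisModule ((p ^ k : ℕ) : ℤ)) 1) ∈
        (((selmerF0 W ((p ^ k : ℕ) : ℤ) 𝒯 𝒮 (placesDividing K s.1) Qcar).relaxedAt {v}).selmerGroup)) ∧
        (∀ (s : {m : ℕ // Squarefree m ∧ ∀ q ∈ m.primeFactors,
        Zhang2014.IsKolyvaginPrime (W.conductorNorm ℤ) W K p q ∧ k ≤ Zhang2014.kolyvaginIndex W p q})
      (ℓ : ℕ), Zhang2014.IsKolyvaginPrime (W.conductorNorm ℤ) W K p ℓ →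
      k ≤ Zhang2014.kolyvaginIndex W p ℓ → ¬ ℓ ∣ s.1 → (∀ q ∈ s.1.primeFactors, q < ℓ) → n ∣ s.1 →
      ∀ v : HeightOneSpectrum (𝓞 K), (ℓ : 𝓞 K) ∈ v.asIdeal →
      ∃ (Sg : Type) (_ : AddCommGroup Sg)
        (sing : signPart W K τ ((p ^ k : ℕ) : ℤ) (if !eb s.1 then 1 else -1)
            (((selmerF0 W ((p ^ k : ℕ) : ℤ) 𝒯 𝒮 (placesDividing K s.1) Qcar).relaxedAt {v}).selmerGroup)
          →+ Sg),
        (∀ x, sing x = 0 ↔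
          (x : galoisCohomology ((W.baseChange K).torsionGaloisModule ((p ^ k : ℕ) : ℤ)) 1) ∈
            signPart W K τ ((p ^ k : ℕ) : ℤ) (if !eb s.1 then 1 else -1)
              ((selmerF0 W ((p ^ k : ℕ) : ℤ) 𝒯 𝒮 (placesDividing K s.1) Qcar).selmerGroup)) ∧
        Nat.card sing.range *
          Nat.card ((C' s.1).map (galoisCohomology.localization
            ((W.baseChange K).torsionGaloisModule ((p ^ k : ℕ) : ℤ)) (Sum.inr v) 1)) = p ^ k) := by
  intro W _ _ _ K _ _ Dt β ι hr hmult hρ hK hHN hodd hD3 hLt hβ hc3 τ hτ v k hk htk n d hn D hDd ε hε eb heb hebε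
  have hp : p.Prime := Fact.out
  haveI hRCF' : ∀ j : ℕ, NumberField (ringClassField K ι j) := fun j ↦ numberField_ringClassField K hK ι j
  have h3n : ((p ^ k : ℕ) : ℤ) ≠ 0 := by exact_mod_cast pow_ne_zero k hp.ne_zero
  haveI : NeZero (p ^ k) := ⟨pow_ne_zero k hp.ne_zero⟩
  haveI : Finite (geomTorsion (W.baseChange K) ((p ^ k : ℕ) : ℤ)) :=
    finite_geomTorsion_of_neZero (W.baseChange K) (p ^ k)
  -- frame facts: `(N, d_K) = 1`, `d_K < -4`, `p ∣ N`, `τ² = 1`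
  have hND : IsCoprime ((W.conductorNorm ℤ : ℕ) : ℤ) (NumberField.discr K) :=
    KolyvaginAssembly.isCoprime_discr_of_satisfiesHeegnerHypothesis hK hHN
  have h3N : p ∣ W.conductorNorm ℤ := dvd_conductorNorm_of_mult (W := W) hmult
  have hD : NumberField.discr K < -4 := by
    have hneg : NumberField.discr K < 0 := hK.discr_neg
    have h4 : NumberField.discr K % 4 = 0 ∨ NumberField.discr K % 4 = 1 :=
      Literature.NumberTheory.QuadraticFields.Quadratic.discr_emod_four (K := K) hK.1
    obtain ⟨r, hr⟩ := hodd
    omega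
  have hD4 : NumberField.discr K ≠ -4 := by omega
  have hτ2 : τ * τ = 1 := algEquiv_mul_self_eq_one hK τ hτ
  -- admissible numbers are divisor-closed; the data system at the divisors of an admissible `s`
  have hadm : ∀ (s : {m : ℕ // Squarefree m ∧ ∀ q ∈ m.primeFactors,
      Zhang2014.IsKolyvaginPrime (W.conductorNorm ℤ) W K p q ∧ k ≤ Zhang2014.kolyvaginIndex W p q})
      (m : ℕ), m ∣ s.1 → Squarefree m ∧ ∀ q ∈ m.primeFactors,
      Zhang2014.IsKolyvaginPrime (W.conductorNorm ℤ) W K p q ∧ k ≤ Zhang2014.kolyvaginIndex W p q :=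
    fun s m hm ↦ ⟨s.2.1.squarefree_of_dvd hm,
      fun q hq ↦ s.2.2 q (Nat.primeFactors_mono hm s.2.1.ne_zero hq)⟩
  -- Gross 1991 §6 ∕ [GZ86 III (p.1)] at this frame, in the Kolyvagin-scoped receptacle form (bsd-jet)
  obtain ⟨n', hcop', hGZ'⟩ := forall_hGZ_of_Gross1991 hF1 W K hK hD3 hD4 hHN p hp2 hρ Dt β ι
  -- the GLOBAL intrinsic transverse family at level `p^k`
  obtain ⟨𝒯, h𝒯, -⟩ := exists_globalTransverseFamily W ι ((p ^ k : ℕ) : ℤ)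
  -- the transverse local facts for the global family at the places of every admissible conductor
  have h𝒯σ' : ∀ (s : {m : ℕ // Squarefree m ∧ ∀ q ∈ m.primeFactors,
        Zhang2014.IsKolyvaginPrime (W.conductorNorm ℤ) W K p q ∧ k ≤ Zhang2014.kolyvaginIndex W p q})
      (v w : HeightOneSpectrum (𝓞 K)) (h : τ • v = w), v ∈ placesDividing K s.1 →
      ∀ x : galoisCohomology (((W.baseChange K).torsionGaloisModule ((p ^ k : ℕ) : ℤ)).toLocal
        (Sum.inr v : Place K)) 1,
      x ∈ 𝒯 (Sum.inr v) → conjActPlace W τ ((p ^ k : ℕ) : ℤ) h x ∈ 𝒯 (Sum.inr w) :=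
    fun s v w h hv x hx ↦ globalTransverse_conjActPlace_mem h𝒯 τ s.2.1
      (forall_conjActPlace_mem_of_eq_iInf_transverseSubgroup W hK ι τ _ s.1) v w h hv x hx
  -- the carrier package: `𝒮`, the split place `v₀`, (δ) of order `p^t`, membership at the carrier
  obtain ⟨𝒮, v₀, hS, hv₀, hv₀N, hv₀N', h𝒮σ, hcyc, hidx, h𝒮mem⟩ :=
    exists_carrierPackage_kolyvagin W K hK hD3 hD4 τ hτ hHN p hp2 h3N hρ Dt β ι hcop' hGZ'
      kodairaNeron_isAddCyclic_forall v k h3n htk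
      (fun c hc hcK q hqN ℓ hℓK hkℓ hℓc d' ↦
        localization_kolyvaginClass_mem_stringentFamily_carrier_kolyvagin W K hK hD3 hD4 hHN hp2 hρ Dt β ι
          hcop' hGZ' τ h3n hc hcK q hqN ℓ hℓK hkℓ hℓc d' q (Finset.mem_insert_self _ _))
  -- the duality conjuncts (bsd-jet Poitou–Tate packages; Weil datum and `τ² = 1` inside)
  obtain ⟨C', hC, hdual_q, hdual_ℓ⟩ := exists_dualityConjuncts_of_localFacts W (hPT K) hK ι τ hτ p k hp2
    hk h𝒯 (fun c _ _ 𝒯c h𝒯c ↦ forall_conjActPlace_mem_of_eq_iInf_transverseSubgroup W hK ι τ _ c 𝒯c h𝒯c)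
    (fun c hc hcK 𝒯c h𝒯c e hμ hadd₁ hadd₂ hgal halt hnondeg inv hperf w hw ↦
      RingClassTransverse.dualTransported_eq_of_localTransverseFamily W K hK hD ι p hp2 k hk c hc
        (fun ℓ hℓ ↦ (hcK ℓ hℓ).1) (fun ℓ hℓ ↦ (hcK ℓ hℓ).2) 𝒯c h𝒯c e hμ hadd₁ hadd₂ hgal halt hnondeg
        inv hperf w hw)
    (kolyvaginLocalTerm_of_poitouTate hPT W K hK τ hτ p k hp2 hk) eb n 𝒮 hS v₀ hv₀
    hv₀N h𝒮σ hcyc hidx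
  refine ⟨𝒯, 𝒮, {v₀, τ • v₀}, C', hS, ?_, ?_, ?_, ?_, hC, hdual_q, ?_, hdual_ℓ⟩
  · -- hQcar
    intro q hq
    simp only [Finset.mem_insert, Finset.mem_singleton] at hq
    rcases hq with rfl | rfl <;> assumption
  · -- hdisj ([J] §4.2 at one completion)
    intro ℓ hℓK hkℓ _ w hw
    exact globalTransverse_disjoint_kummer h𝒯
      (P := fun ℓ ↦ Zhang2014.IsKolyvaginPrime (W.conductorNorm ℤ) W K p ℓ ∧
        k ≤ Zhang2014.kolyvaginIndex W p ℓ)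
      (fun ℓ hℓ w hw ↦ disjoint_kummer_iInf_transverseSubgroup W K hK hD ι k hℓ.1 w hw)
      (fun ℓ hℓ ↦ hℓ.1.1) ℓ ⟨hℓK, hkℓ⟩ w hw
  · -- hPT (Lemma 5.2 (iii), primal form)
    intro s ℓ hℓK hkℓ hℓs _ _ w hw b
    obtain ⟨inv, hperf, hvan, -, hSC, hconj⟩ := hPT K (p ^ k)
    have h2 : 2 ≤ p ^ k := le_trans hp.two_le (le_trans (pow_one p).ge (Nat.pow_le_pow_right hp.pos hk))
    obtain ⟨e, hμ, hadd₁, hadd₂, hgal, halt, hnondeg, hτe⟩ := exists_weilDatum_liftAut W τ (p ^ k) h2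
    have hs' : (if b then (1 : ℤ) else -1) = 1 ∨ (if b then (1 : ℤ) else -1) = -1 := by
      cases b <;> simp
    have hℓs' : ℓ ∉ s.1.primeFactors := fun h ↦ hℓs (Nat.dvd_of_mem_primeFactors h)
    exact natCard_map_localization_signPart_relaxedAt W τ p k e hμ hadd₁ hadd₂ hgal halt hnondeg hτe
      hτ2 hp2 hk inv hperf hvan hSC (hconj τ) 𝒯 s.2.1.ne_zero (h𝒯σ' s)
      (globalTransverse_dualTransported_eq (ι := ι) h𝒯 s.2.1
        (fun 𝒯c h𝒯c inv' hperf' w' hw' ↦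
          RingClassTransverse.dualTransported_eq_of_localTransverseFamily W K hK hD ι p hp2 k hk s.1 s.2.1
            (fun ℓ hℓ ↦ (s.2.2 ℓ hℓ).1) (fun ℓ hℓ ↦ (s.2.2 ℓ hℓ).2) 𝒯c h𝒯c e hμ hadd₁ hadd₂ hgal halt
            hnondeg inv' hperf' w' hw')
        inv hperf)
      hs' (fun ℓ' h1 h2 _ v' hv' hfix ↦
        kolyvaginLocalTerm_of_poitouTate hPT W K hK τ hτ p k hp2 hk ℓ' h1 h2 v' hv' hfix _ hs')
      ℓ hℓK hkℓ hℓs' w hw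
  · -- hselmer (root classes)
    intro s u Q hAk hQ hQP hndvd huk
    have hsKu : ∀ q ∈ s.1.primeFactors, Zhang2014.IsKolyvaginPrime (W.conductorNorm ℤ) W K p q ∧
        k + u ≤ Zhang2014.kolyvaginIndex W p q := fun q hq ↦
      ⟨(s.2.2 q hq).1, by
        rw [Nat.add_comm]
        exact Zhang2014.natCast_le_levelIndex_iff.mp huk q hq⟩
    -- invariance of `[P_s]` mod `p^{k+u}` from the data at the divisors of `s`
    have hP : (D s).toGeomPoints (D s).derivedPoint ∈
        invPoints (absoluteGaloisGroup K) (D s).pointsSubgroup ((p ^ (k + u) : ℕ) : ℤ) :=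
      Three.KolyCert.toGeomPoints_derivedPoint_mem_invPoints_of_dvd_zhang hK ι Dt hp hND hD s.2.1 hsKu
        (fun m hm ↦ D ⟨m, hadm s m hm⟩) s.1 dvd_rfl
    exact rootClass_mem_selmerGroup_selmerF_of_levelUp_kolyvagin W h𝒯 hK hD3 hD4 hHN hp2 hρ hcop' hGZ' s.2.1
      hsKu
      (D s) Q hAk hQ hQP hP (fun ℓ hℓ ↦ kolyvaginClass_mem_transverseKer W hK hD hp2 Dt β ι (k + u) s.2.1 hsKu (D s) hℓ)
  · -- hsel0
    intro s s' ℓ hℓ hℓs hss' _ _ w hw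
    have hs0 : s.1 ≠ 0 := s.2.1.ne_zero
    have hℓs' : ℓ ∈ s'.1.primeFactors := by
      rw [hss']; exact Nat.mem_primeFactors.mpr ⟨hℓ, dvd_mul_left ℓ s.1, mul_ne_zero hs0 hℓ.ne_zero⟩
    have hℓK : Zhang2014.IsKolyvaginPrime (W.conductorNorm ℤ) W K p ℓ := (s'.2.2 ℓ hℓs').1
    have hkℓ : k ≤ Zhang2014.kolyvaginIndex W p ℓ := (s'.2.2 ℓ hℓs').2
    have hℓs'' : ℓ ∉ s.1.primeFactors := fun h ↦ hℓs (Nat.dvd_of_mem_primeFactors h)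
    have htr' : ∀ q ∈ s.1.primeFactors,
        ((D s').kolyvaginClass (Fact.out : p.Prime) k :
          galoisCohomology ((W.baseChange K).torsionGaloisModule ((p ^ k : ℕ) : ℤ)) 1) ∈
          transverseKer W K ι ((p ^ k : ℕ) : ℤ) q := fun q hq ↦
      kolyvaginClass_mem_transverseKer W hK hD hp2 Dt β ι k s'.2.1 s'.2.2 (D s')
        (by rw [hss']; exact Nat.primeFactors_mono (dvd_mul_right s.1 ℓ) (mul_ne_zero hs0 hℓ.ne_zero) hq)
    exact kolyvaginClass_mem_selmerGroup_selmerF0_relaxedAt_kolyvagin W h𝒯 hK hD3 hD4 hHN hp2 hρ hcop' hGZ' 𝒮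
      {v₀, τ • v₀} s.2.1 s.2.2 hℓK hkℓ hℓs hss' (D s') w hw htr'
      (fun q hq ↦ by
        have := h𝒮mem q hq s.1 s.2.1 s.2.2 ℓ hℓK hkℓ hℓs''
        rw [← hss'] at this
        exact this (D s'))

end Summit.BirchSwinnertonDyer.Rank1Residual.X11b.AtP.Koly

end
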